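import Summits.BirchSwinnertonDyer.BirchSwinnertonDyer.Theorems.ManinLocalTwoThreeNewformThirtySix
import Summits.BirchSwinnertonDyer.BirchSwinnertonDyer.Theorems.ManinLocalTwoThreeHexagonalSqueezeTwentySeven
import HarnessLib

/-!
# The hexagonal squeeze at level 36: `e^{2πi/3}·Λ(φ₃₆) ⊆ Λ(φ₃₆)`, and `Λ(φ₃₆) ⊆ Λ(0, −4) ⟹ |c| = 1` on `X₀(36)`

Cell bsd-f2-manin, route `ManinLocalTwoThree` (cruxes C2 `ManinOddAtFour` stmt-22967 — `4 ∣ 36` — and C3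
`ManinPrimeToThreeAtNine` stmt-22968 — `9 ∣ 36`), prover seat p2 gen 26.  The level-`36` run of the
architecture of `HexagonalSqueezeTwentySeven` (p3 g22) / -an g49 §94 (`N = 27, 32`): `X₀(36) = 36a1 :
y² = x³ + 1` (`c₄ = 0`, `c₆ = −864`, Néron invariants `g₂ = 0`, `g₃ = −4`), newform
`φ₃₆ = η(6τ)⁴` (the tree's `cuspFormEtaProductThirtySix`; `D.f = φ₃₆` for every `X₀(36)`-datum by
`NewformThirtySix.f_eq_etaProductThirtySix`).

* §2 (S1)₃₆ PROVED: **`e^{2πi/3}·Λ(φ₃₆) ⊆ Λ(φ₃₆)`** — `φ₃₆(τ + ⅓) = e^{2πi/3} φ₃₆(τ)` (`η(6τ + 2) =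
  e^{2πi·2/24} η(6τ)`), the Eichler integral picks up the same factor, and `t = (1 ⅓; 0 1)` normalises
  `Γ₀(36)` (`9 ∣ 36`, `3 ∣ 24`).
* §3 THE SQUEEZE: if `Λ(φ₃₆) ⊆ Λ₁` for a period pair with `g₂ = 0`, `g₃ = −4` (hypothesis (S2)₃₆; its
  `η`-certificate `x = η₁₂η₁₈³/(η₆η₃₆³)`, `Y = η₁₂⁴η₁₈²/(η₆²η₃₆⁴)`, `Y² = x³ + 1`, `x′ = −2πiφ₃₆·2Y` is the
  business of the sibling file `…EtaIdentityReductionThirtySix`), then **`|c(D)| = 1`** for every globally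
  minimal `W/ℚ` and every `X₀(36)`-datum `D` with the lattice clause: both `Λ_W ⊆ cΛ₁` are
  `ℤ[ω]`-lattices, so `Λ_W = ν·cΛ₁` (`ν ∈ ℤ[ω]`), `c₆(W)(cν)⁶ = −864`, and `|c₆|·(c²N(ν))³ = 864 = 2⁵3³`
  forces `c² = 1` — no congruence on `c₆` is needed.
* §4 Corollaries in the shape of C2 (`2 ∤ c`) and C3 (`3 ∤ c`) at `N = 36`, modulo (S2)₃₆.

HONEST FRAMING: §2 unconditional; §3–§4 conditional on the explicit hypothesis (S2)₃₆ only (no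
modularity binder, no Calegari–Dimitrov–Tang, no printed Manin fact).  Nothing here proves C2, C3,
Manin's conjecture or BSD; the items stay OPEN as filed.  No definition, no named fact, no sorry.
[cite: CremonaAlgorithms1997, Table 1 (36a1) and §2.8] [cite: Manin1972, Prop. 1.4 / §1.6]
[cite: Koehler2011, §1] [cite: Ligozat1975, Ch. 4] [cite: SilvermanAEC2009, Thm. VI.5.1]
-/

set_option autoImplicit false
-- lint-debt: the directory name repeats the summit name (sibling precedent `ManinLocalTwoThreeHexagonalSqueezeTwentySeven.lean`)
set_option linter.dupNamespace false

noncomputable section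

open scoped MatrixGroups ModularForm Topology Real
open Filter CongruenceSubgroup WeierstrassCurve Function Complex
open UpperHalfPlane hiding I
open Literature.NumberTheory.EllipticCurves Literature.NumberTheory.EllipticCurves.ModularForms

namespace Summit.BirchSwinnertonDyer.BirchSwinnertonDyer.Theorems.ManinLocalTwoThree.HexagonalSqueezeThirtySix

/-! ## §2 (S1)₃₆: `e^{2πi/3} · Λ(φ₃₆) ⊆ Λ(φ₃₆)` via the shift `t = (1 ⅓; 0 1)` -/

/-- `(e^{2πi·2/24})⁴ = e^{2πi/3}`. [folklore] -/
theorem cexp_two_pow_four : cexp (2 * π * I * ((2 : ℤ) : ℂ) / 24) ^ 4 = cexp (2 * π * I / 3) := by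
  rw [← Complex.exp_nat_mul]
  congr 1
  push_cast
  ring

/-- **`φ₃₆(τ + ⅓) = e^{2πi/3} φ₃₆(τ)`** (`η(6τ + 2) = e^{2πi·2/24} η(6τ)`). [cite: Koehler2011, §1] -/
theorem etaProductThirtySix_vadd_third (τ : ℍ) :
    etaProductThirtySix (((1 : ℝ) / 3 : ℝ) +ᵥ τ) = cexp (2 * π * I / 3) * etaProductThirtySix τ := by
  rw [etaProductThirtySix_apply, etaProductThirtySix_apply]
  have h6 : (6 : ℂ) * (((((1 : ℝ) / 3 : ℝ) +ᵥ τ : ℍ)) : ℂ) = 6 * (τ : ℂ) + ((2 : ℤ) : ℂ) := by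
    rw [coe_vadd]; push_cast; ring
  rw [h6, eta_add_intCast, ← cexp_two_pow_four]
  ring

/-- **`ℰ_φ(τ + ⅓) = e^{2πi/3} · ℰ_φ(τ)`** for `ℰ_φ = 2πi ∫_{i∞}^τ φ₃₆` (shift the vertical ray). [cite: Manin1972, §1.6] -/
theorem eichlerIntegral_vadd_oneThird (τ : ℍ) :
    eichlerIntegral cuspFormEtaProductThirtySix (((1 : ℝ) / 3 : ℝ) +ᵥ τ) =
      cexp (2 * π * I / 3) * eichlerIntegral cuspFormEtaProductThirtySix τ := by
  unfold eichlerIntegral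
  have hint : (∫ t in Set.Ioi (0 : ℝ),
        cuspFormEtaProductThirtySix (ofComplex ((((((1 : ℝ) / 3 : ℝ) +ᵥ τ : ℍ)) : ℂ) + t * Complex.I)))
      = cexp (2 * π * I / 3) *
          ∫ t in Set.Ioi (0 : ℝ), cuspFormEtaProductThirtySix (ofComplex ((τ : ℂ) + t * Complex.I)) := by
    rw [← MeasureTheory.integral_const_mul]
    refine MeasureTheory.setIntegral_congr_fun measurableSet_Ioi fun s hs ↦ ?_
    have hs' : 0 < s := Set.mem_Ioi.mp hs
    have h1 : 0 < ((τ : ℂ) + s * Complex.I).im := by simpa using add_pos τ.im_pos hs'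
    have h2 : 0 < ((((((1 : ℝ) / 3 : ℝ) +ᵥ τ : ℍ)) : ℂ) + s * Complex.I).im := by
      simpa using add_pos ((((1 : ℝ) / 3 : ℝ)) +ᵥ τ).im_pos hs'
    rw [ofComplex_apply_of_im_pos h1, ofComplex_apply_of_im_pos h2]
    have hpt : (⟨_, h2⟩ : ℍ) = (((1 : ℝ) / 3 : ℝ)) +ᵥ (⟨(τ : ℂ) + s * Complex.I, h1⟩ : ℍ) := by
      apply UpperHalfPlane.ext
      simp only [coe_vadd]
      ring
    rw [hpt, show (cuspFormEtaProductThirtySix : ℍ → ℂ) = etaProductThirtySix from rfl,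
      etaProductThirtySix_vadd_third]
  rw [hint]
  ring

/-- **`t = (1 ⅓; 0 1)` normalises `Γ₀(36)`**: for `γ ∈ Γ₀(36)` there is `γ′ ∈ Γ₀(36)` with
`γ′ • (τ + ⅓) = γ • τ + ⅓` (`γ′ = (a + c/3, b + (d − a)/3 − c/9; c, d − c/3)`, integral because `36 ∣ c`
and `a ≡ d (mod 3)`). [cite: Manin1972, Prop. 1.4] -/
theorem exists_conj_oneThird (γ : Gamma0 36) :
    ∃ γ' : Gamma0 36, ∀ τ : ℍ, ((γ' : SL(2, ℤ)) • (((1 : ℝ) / 3 : ℝ) +ᵥ τ) : ℍ) =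
      ((1 : ℝ) / 3 : ℝ) +ᵥ ((γ : SL(2, ℤ)) • τ) := by
  set a : ℤ := (γ : SL(2, ℤ)) 0 0 with ha
  set b : ℤ := (γ : SL(2, ℤ)) 0 1 with hb
  set c : ℤ := (γ : SL(2, ℤ)) 1 0 with hc
  set d : ℤ := (γ : SL(2, ℤ)) 1 1 with hd
  have hdet : a * d - b * c = 1 := by
    have h := Matrix.det_fin_two ((γ : SL(2, ℤ)) : Matrix (Fin 2) (Fin 2) ℤ)
    rw [(γ : SL(2, ℤ)).det_coe] at h
    rw [ha, hb, hc, hd]; linarith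
  have hc36 : (36 : ℤ) ∣ c := by
    have h := γ.2
    rw [Gamma0_mem] at h
    exact (ZMod.intCast_zmod_eq_zero_iff_dvd _ 36).mp h
  obtain ⟨k, hk⟩ := hc36
  have had : (3 : ℤ) ∣ d - a := by
    have key : ∀ a d : ZMod 3, a * d = 1 → d - a = 0 := by decide
    have h1 : ((a : ZMod 3)) * (d : ZMod 3) = 1 := by
      have h := congrArg (fun z : ℤ ↦ (z : ZMod 3)) hdet
      rw [hk] at h
      push_cast at h
      have h36 : (36 : ZMod 3) = 0 := by decide
      simp only [h36, zero_mul, mul_zero, sub_zero] at h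
      exact h
    have h2 := key _ _ h1
    have : (((d - a : ℤ)) : ZMod 3) = 0 := by push_cast; exact h2
    exact (ZMod.intCast_zmod_eq_zero_iff_dvd _ 3).mp this
  obtain ⟨m, hm⟩ := had
  -- the conjugated matrix
  let M : Matrix (Fin 2) (Fin 2) ℤ := !![a + 12 * k, b + m - 4 * k; 36 * k, d - 12 * k]
  have hMdet : M.det = 1 := by
    rw [Matrix.det_fin_two_of]
    linear_combination hdet + b * hk + 12 * k * hm
  let γ'' : SL(2, ℤ) := ⟨M, hMdet⟩
  have hmem : γ'' ∈ Gamma0 36 := by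
    rw [Gamma0_mem]
    exact (ZMod.intCast_zmod_eq_zero_iff_dvd _ 36).mpr ⟨k, rfl⟩
  refine ⟨⟨γ'', hmem⟩, fun τ ↦ ?_⟩
  -- non-vanishing of the denominator `cτ + d`
  have hcd : (![((36 * k : ℤ) : ℝ), ((d : ℤ) : ℝ)] : Fin 2 → ℝ) ≠ 0 := by
    intro h
    have h0 := congrFun h 0
    have h1 := congrFun h 1
    simp only [Matrix.cons_val_zero, Matrix.cons_val_one, Pi.zero_apply, Int.cast_eq_zero] at h0 h1
    rw [hk, h0, h1] at hdet
    simp at hdet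
  have hden := UpperHalfPlane.linear_ne_zero τ hcd
  simp only [Matrix.cons_val_zero, Matrix.cons_val_one, Complex.ofReal_intCast] at hden
  apply UpperHalfPlane.ext
  rw [UpperHalfPlane.coe_vadd, coe_specialLinearGroup_apply, coe_specialLinearGroup_apply]
  have e00 : ((((⟨γ'', hmem⟩ : Gamma0 36) : SL(2, ℤ)) 0 0 : ℤ)) = a + 12 * k := rfl
  have e01 : ((((⟨γ'', hmem⟩ : Gamma0 36) : SL(2, ℤ)) 0 1 : ℤ)) = b + m - 4 * k := rfl
  have e10 : ((((⟨γ'', hmem⟩ : Gamma0 36) : SL(2, ℤ)) 1 0 : ℤ)) = 36 * k := rfl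
  have e11 : ((((⟨γ'', hmem⟩ : Gamma0 36) : SL(2, ℤ)) 1 1 : ℤ)) = d - 12 * k := rfl
  rw [e00, e01, e10, e11, UpperHalfPlane.coe_vadd]
  simp only [← ha, ← hb, ← hc, ← hd, hk, eq_intCast, Complex.ofReal_intCast]
  have hm' : (d : ℂ) - (a : ℂ) = 3 * (m : ℂ) := by exact_mod_cast hm
  have hden_eq : (((36 * k : ℤ)) : ℂ) * ((((1 : ℝ) / 3 : ℝ) : ℂ) + (τ : ℂ)) + ((d - 12 * k : ℤ) : ℂ)
      = ((36 * k : ℤ) : ℂ) * (τ : ℂ) + (d : ℂ) := by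
    push_cast; ring
  have hnum_eq : (((a + 12 * k : ℤ)) : ℂ) * ((((1 : ℝ) / 3 : ℝ) : ℂ) + (τ : ℂ)) + ((b + m - 4 * k : ℤ) : ℂ) =
      ((a : ℂ) * (τ : ℂ) + (b : ℂ)) + (((36 * k : ℤ) : ℂ) * (τ : ℂ) + (d : ℂ)) / 3 := by
    push_cast
    linear_combination (-(1 : ℂ) / 3) * hm'
  rw [hden_eq, hnum_eq, add_div, add_comm]
  congr 1
  push_cast at hden ⊢
  field_simp

/-- **`e^{2πi/3} · {∞, γ∞}_φ = {∞, γ′∞}_φ`** with `γ′ = tγt⁻¹ ∈ Γ₀(36)`: a period rotated by `e^{2πi/3}` is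
again a period. [cite: Manin1972, Prop. 1.4] -/
theorem omega_mul_cuspSymbol_mem (γ : Gamma0 36) :
    cexp (2 * π * I / 3) * cuspSymbol cuspFormEtaProductThirtySix γ ∈
      periodLattice cuspFormEtaProductThirtySix := by
  obtain ⟨γ', hγ'⟩ := exists_conj_oneThird γ
  have h := eichlerIntegral_smul_sub_holds cuspFormEtaProductThirtySix γ UpperHalfPlane.I
  have h' := eichlerIntegral_smul_sub_holds cuspFormEtaProductThirtySix γ'
    (((1 : ℝ) / 3 : ℝ) +ᵥ UpperHalfPlane.I)
  rw [hγ' UpperHalfPlane.I, eichlerIntegral_vadd_oneThird, eichlerIntegral_vadd_oneThird, ← mul_sub, h]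
    at h'
  rw [h']
  exact AddSubgroup.subset_closure ⟨γ', rfl⟩

/-- **(S1)₃₆: the period lattice of `φ₃₆ = η(6τ)⁴` is stable under multiplication by `e^{2πi/3}`** (it is
a `ℤ[ω]`-module: the CM of `X₀(36) = 36a1`).  UNCONDITIONAL. [cite: Manin1972, Prop. 1.4 / §1.6]
[cite: CremonaAlgorithms1997, §2.8] -/
theorem omegaStable_periodLattice_thirtySix :
    ∀ z ∈ periodLattice cuspFormEtaProductThirtySix,
      cexp (2 * π * I / 3) * z ∈ periodLattice cuspFormEtaProductThirtySix := by
  intro z hz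
  induction hz using AddSubgroup.closure_induction with
  | mem x hx =>
    obtain ⟨γ, rfl⟩ := hx
    exact omega_mul_cuspSymbol_mem γ
  | zero => rw [mul_zero]; exact zero_mem _
  | add x y _ _ hx hy => rw [mul_add]; exact add_mem hx hy
  | neg x _ hx => rw [mul_neg]; exact neg_mem hx

/-! ## §3 The squeeze: (S2)₃₆ `Λ(φ₃₆) ⊆ Λ(0, −4)` ⟹ `|c| = 1` on `X₀(36)` -/

/-- **The arithmetic endgame at 36.** `|m|·(c²n)³ = 864 = 2⁵·3³` with `n ≥ 1` forces `|c| = 1`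
(`(c²n)³ ∣ 864` gives `c²n ∈ {1, 2, 3, 6}`, none divisible by `4`). [folklore] -/
theorem abs_eq_one_of_arith36 (m c n : ℤ) (hn : 1 ≤ n) (h : |m| * (c ^ 2 * n) ^ 3 = 864) : |c| = 1 := by
  obtain ⟨μ, hμ⟩ : ∃ μ : ℤ, μ = |m| := ⟨_, rfl⟩
  obtain ⟨k, hk⟩ : ∃ k : ℤ, k = c ^ 2 * n := ⟨_, rfl⟩
  rw [← hμ, ← hk] at h
  have hμ0 : 0 ≤ μ := hμ ▸ abs_nonneg _
  have hk0 : 0 ≤ k := by rw [hk]; positivity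
  have hk1 : 1 ≤ k := by
    by_contra hcon; rw [show k = 0 by omega] at h; simp at h
  have hμ1 : 1 ≤ μ := by
    by_contra hcon; rw [show μ = 0 by omega] at h; simp at h
  have hk9 : k ≤ 9 := by
    by_contra hcon
    have h10 : 10 ≤ k := by omega
    have h1000 : (10 : ℤ) ^ 3 ≤ k ^ 3 := pow_le_pow_left₀ (by norm_num) h10 3
    have : k ^ 3 ≤ μ * k ^ 3 := le_mul_of_one_le_left (by positivity) hμ1
    linarith
  have hcases : k = 1 ∨ k = 2 ∨ k = 3 ∨ k = 6 := by interval_cases k <;> omega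
  -- `c² n ∈ {1, 2, 3, 6}` with `n ≥ 1` ⟹ `c² ≤ 6` ⟹ `|c| ≤ 2`, and `c = ±2` would give `4 ∣ c²n`
  have hc2 : c ^ 2 ≤ 6 := by
    rcases hcases with h1 | h2 | h3 | h6 <;> nlinarith [sq_nonneg c]
  have hcb : -2 ≤ c ∧ c ≤ 2 := by constructor <;> nlinarith [sq_nonneg c]
  obtain ⟨hlo, hhi⟩ := hcb
  interval_cases c <;> norm_num at hk ⊢ <;> omega

/-- **Ligozat-36 in the kernel, modulo (S2)₃₆ (with (S1)₃₆ discharged by §2).**  If the period lattice of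
`φ₃₆ = η(6τ)⁴` lies in a period pair with invariants `g₂ = 0`, `g₃ = −4` (the Néron lattice shape of
`36a1 : y² = x³ + 1`), then `|c(D)| = 1` for every globally minimal `W/ℚ` and every `X₀(36)`-datum `D` of
`W` with the lattice clause `Λ_W = c · Λ_f`.  No modularity binder, no Calegari–Dimitrov–Tang. [folklore] -/
theorem abs_maninConstant_eq_one_thirtySix_of_periodLattice_le_hex
    (h2 : ∃ L₁ : PeriodPair, L₁.g₂ = 0 ∧ L₁.g₃ = -4 ∧
      ∀ z ∈ periodLattice cuspFormEtaProductThirtySix, z ∈ L₁.lattice)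
    (W : WeierstrassCurve ℚ) [W.IsGloballyMinimal] (D : ModularParametrizationData W 36)
    (hopt : ∀ z ∈ D.L.lattice, ∃ w ∈ periodLattice D.f, z = D.c * w) :
    |D.maninConstant| = 1 := by
  have h1 := omegaStable_periodLattice_thirtySix
  have hre := HexagonalSqueezeTwentySeven.cexp_twoPiI_div_three_re
  have him := HexagonalSqueezeTwentySeven.cexp_twoPiI_div_three_im
  have hω6 := HexagonalSqueezeTwentySeven.cexp_twoPiI_div_three_pow_six
  have hω0 : cexp (2 * π * I / 3) ≠ 0 := HexagonalSqueezeTwentySeven.ne_zero_of_re_im hre him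
  set ω : ℂ := cexp (2 * π * I / 3)
  have hf : D.f = cuspFormEtaProductThirtySix := NewformThirtySix.f_eq_etaProductThirtySix D
  obtain ⟨L₁, hg2, hg3, hle⟩ := h2
  show |D.c| = 1
  set c : ℤ := D.c with hc_def
  have hc0 : (c : ℂ) ≠ 0 := by
    intro hc
    have hω₁ : D.L.ω₁ ≠ 0 := by simpa using D.L.indep.ne_zero 0
    obtain ⟨w, -, hw⟩ := hopt D.L.ω₁ D.L.ω₁_mem_lattice
    rw [hc, zero_mul] at hw
    exact hω₁ hw
  have hMω : ∀ z ∈ D.L.lattice, ω * z ∈ D.L.lattice := by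
    intro z hz
    obtain ⟨w, hw, rfl⟩ := hopt z hz
    have hw' : ω * w ∈ periodLattice D.f := by
      rw [hf] at hw ⊢; exact h1 _ hw
    have := D.smul_periodLattice_le _ hw'
    convert this using 1; ring
  set P : PeriodPair := L₁.mulLeft (c : ℂ) hc0 with hP
  have hMP : D.L.lattice ≤ P.lattice := by
    intro z hz
    obtain ⟨w, hw, rfl⟩ := hopt z hz
    rw [hf] at hw
    exact PeriodPair.mul_mem_mulLeft_lattice.mpr (hle w hw)
  have hL₁ω : ∀ z ∈ L₁.lattice, ω * z ∈ L₁.lattice := by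
    have heq : (L₁.mulLeft ω hω0).lattice = L₁.lattice := by
      apply PeriodPair.uniformization_unique_holds
      · rw [PeriodPair.g₂_mulLeft, hg2, mul_zero]
      · rw [PeriodPair.g₃_mulLeft, hg3, hω6, inv_one, one_mul]
    intro z hz
    rw [← heq]
    exact PeriodPair.mul_mem_mulLeft_lattice.mpr hz
  have hPω : ∀ z ∈ P.lattice, ω * z ∈ P.lattice := by
    intro z hz
    rw [hP, PeriodPair.mem_mulLeft_lattice] at hz ⊢
    have := hL₁ω _ hz
    convert this using 1; ring
  obtain ⟨a, b, hν, hMeq⟩ :=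
    HexagonalSqueezeTwentySeven.lattice_eq_mulLeft_of_omega_stable hre him hMω hPω hMP
  set ν : ℂ := (a : ℂ) + b * ω with hν_def
  have hg3W : D.L.g₃ = (ν ^ 6)⁻¹ * (((c : ℂ) ^ 6)⁻¹ * (-4)) := by
    rw [PeriodPair.g₃_eq_of_lattice_eq hMeq, PeriodPair.g₃_mulLeft, hP, PeriodPair.g₃_mulLeft, hg3]
  have hN3 : D.L.g₃ = (W.baseChange ℂ).c₆ / 216 := D.isNeronLattice.2
  set Wℤ : WeierstrassCurve ℤ := integralModelInt W with hWℤ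
  have hW : Wℤ.map (Int.castRingHom ℚ) = W := map_integralModelInt W
  have hc6 : (W.baseChange ℂ).c₆ = (Wℤ.c₆ : ℂ) := by
    conv_lhs => rw [← hW]
    simp [WeierstrassCurve.baseChange, WeierstrassCurve.map_c₆]
  set m : ℤ := Wℤ.c₆ with hm
  have key : (m : ℂ) * (ν ^ 6 * (c : ℂ) ^ 6) = -864 := by
    have h : (ν ^ 6)⁻¹ * (((c : ℂ) ^ 6)⁻¹ * (-4)) = (m : ℂ) / 216 := by rw [← hg3W, hN3, hc6]
    have hν6 : ν ^ 6 ≠ 0 := pow_ne_zero _ hν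
    have hc6' : (c : ℂ) ^ 6 ≠ 0 := pow_ne_zero _ hc0
    have hA : (ν ^ 6)⁻¹ * ν ^ 6 = 1 := inv_mul_cancel₀ hν6
    have hB : ((c : ℂ) ^ 6)⁻¹ * (c : ℂ) ^ 6 = 1 := inv_mul_cancel₀ hc6'
    have e1 : (ν ^ 6)⁻¹ * (((c : ℂ) ^ 6)⁻¹ * (-4)) * (ν ^ 6 * (c : ℂ) ^ 6) * 216 = -864 := by
      calc (ν ^ 6)⁻¹ * (((c : ℂ) ^ 6)⁻¹ * (-4)) * (ν ^ 6 * (c : ℂ) ^ 6) * 216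
          = -864 * ((ν ^ 6)⁻¹ * ν ^ 6) * (((c : ℂ) ^ 6)⁻¹ * (c : ℂ) ^ 6) := by ring
        _ = -864 := by rw [hA, hB]; ring
    have e2 : (m : ℂ) / 216 * (ν ^ 6 * (c : ℂ) ^ 6) * 216 = (m : ℂ) * (ν ^ 6 * (c : ℂ) ^ 6) := by
      ring
    rw [← e2, ← h, e1]
  set n : ℤ := a ^ 2 - a * b + b ^ 2 with hn_def
  have hn : Complex.normSq ν = (n : ℝ) := by
    rw [hν_def, hn_def]
    push_cast
    have := HexagonalSqueezeTwentySeven.normSq_add_mul hre him a b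
    push_cast at this
    exact this
  have hn1 : 1 ≤ n := by
    have : (0 : ℝ) < n := by rw [← hn]; exact Complex.normSq_pos.mpr hν
    exact_mod_cast this
  have hR : |(m : ℝ)| * (((c : ℝ) ^ 2 * (n : ℝ)) ^ 3) = 864 := by
    have hnorm := congrArg (‖·‖) key
    simp only [norm_mul, norm_pow, Complex.norm_intCast, norm_neg] at hnorm
    have h864 : ‖(864 : ℂ)‖ = 864 := by
      rw [show (864 : ℂ) = ((864 : ℕ) : ℂ) by norm_num, Complex.norm_natCast]; norm_num
    have hν2 : ‖ν‖ ^ 2 = (n : ℝ) := by rw [Complex.sq_norm, hn]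
    have hc2 : |(c : ℝ)| ^ 2 = (c : ℝ) ^ 2 := sq_abs _
    calc |(m : ℝ)| * (((c : ℝ) ^ 2 * (n : ℝ)) ^ 3)
        = |(m : ℝ)| * ((‖ν‖ ^ 2) ^ 3 * (|(c : ℝ)| ^ 2) ^ 3) := by rw [hν2, hc2]; ring
      _ = |(m : ℝ)| * (‖ν‖ ^ 6 * |(c : ℝ)| ^ 6) := by ring
      _ = 864 := by rw [hnorm, h864]
  have hZ : |m| * (c ^ 2 * n) ^ 3 = 864 := by exact_mod_cast hR
  exact abs_eq_one_of_arith36 m c n hn1 hZ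

/-! ## §4 Corollaries in the shape of the route items at `N = 36` (modulo (S2)₃₆) -/

/-- C2 `ManinOddAtFour` at `N = 36` (`4 ∣ 36`), fact-free modulo (S2)₃₆: `2 ∤ c(D)`. [folklore] -/
theorem not_two_dvd_maninConstant_thirtySix_of_periodLattice_le_hex
    (h2 : ∃ L₁ : PeriodPair, L₁.g₂ = 0 ∧ L₁.g₃ = -4 ∧
      ∀ z ∈ periodLattice cuspFormEtaProductThirtySix, z ∈ L₁.lattice)
    (W : WeierstrassCurve ℚ) [W.IsGloballyMinimal] (D : ModularParametrizationData W 36)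
    (hopt : ∀ z ∈ D.L.lattice, ∃ w ∈ periodLattice D.f, z = D.c * w) :
    ¬ (2 : ℤ) ∣ D.maninConstant := by
  have h := abs_maninConstant_eq_one_thirtySix_of_periodLattice_le_hex h2 W D hopt
  intro h3
  have := Int.le_of_dvd (by rw [h]; norm_num) ((dvd_abs _ _).mpr h3)
  rw [h] at this
  norm_num at this

/-- C3 `ManinPrimeToThreeAtNine` at `N = 36` (`9 ∣ 36`), fact-free modulo (S2)₃₆: `3 ∤ c(D)`. [folklore] -/
theorem not_three_dvd_maninConstant_thirtySix_of_periodLattice_le_hex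
    (h2 : ∃ L₁ : PeriodPair, L₁.g₂ = 0 ∧ L₁.g₃ = -4 ∧
      ∀ z ∈ periodLattice cuspFormEtaProductThirtySix, z ∈ L₁.lattice)
    (W : WeierstrassCurve ℚ) [W.IsGloballyMinimal] (D : ModularParametrizationData W 36)
    (hopt : ∀ z ∈ D.L.lattice, ∃ w ∈ periodLattice D.f, z = D.c * w) :
    ¬ (3 : ℤ) ∣ D.maninConstant := by
  have h := abs_maninConstant_eq_one_thirtySix_of_periodLattice_le_hex h2 W D hopt
  intro h3
  have := Int.le_of_dvd (by rw [h]; norm_num) ((dvd_abs _ _).mpr h3)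
  rw [h] at this
  norm_num at this

end Summit.BirchSwinnertonDyer.BirchSwinnertonDyer.Theorems.ManinLocalTwoThree.HexagonalSqueezeThirtySix

end
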